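import Literature.Analysis.FunctionSpaces.SobolevDomainProofs
import Literature.Analysis.FunctionSpaces.GagliardoNirenbergSobolev
import HarnessLib

/-!
# Discharged fact: the Gagliardo–Nirenberg–Sobolev inequality on `W₀^{1,p}(Ω)`

`Literature.Analysis.FunctionSpaces.SobolevDomain` records the **Gagliardo–Nirenberg–Sobolev
inequality** on `W₀^{1,p}(Ω)` as the named fact `Literature.Analysis.FunctionSpaces.gagliardo_nirenberg_sobolev`: for
`1 ≤ p < n = dim E'`, `1/p* = 1/p - 1/n`, complete `F` and an additive Haar measure `μ`, there is
`C` with `‖f‖_{L^{p*}(Ω)} ≤ C ‖Df‖_{L^p(Ω)}` for every `f ∈ W₀^{1,p}(Ω; F)` with weak derivative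
`Df = g` (Evans, *PDE*, §5.6.1, Theorem 1 for `u ∈ C¹_c(ℝⁿ)` and the density step of the proof of
Theorem 3 for `u ∈ W₀^{1,p}(U)`; Brezis, Thm. 9.9; Adams (1975), 5.11 (21)). This file proves it,
`Literature.Analysis.FunctionSpaces.gagliardo_nirenberg_sobolev_holds`.

The `C¹_c` inequality for an arbitrary normed codomain is
`Literature.Analysis.FunctionSpaces.eLpNorm_le_mul_eLpNorm_fderiv_of_eq` (`Literature.Analysis.FunctionSpaces.GagliardoNirenbergSobolev`,
Mathlib's proof of `MeasureTheory.eLpNorm_le_eLpNorm_fderiv_of_eq_inner` with norming functionals in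
place of the differentiability of `‖·‖ ^ γ`); this file supplies the density passage, with the
auxiliary results `Literature.Analysis.FunctionSpaces.exists_opNorm_le_mul_sum_basis` (operator norm vs. values on a basis),
`Literature.Analysis.FunctionSpaces.eLpNorm_le_mul_sum_eLpNorm_apply_basis` (its `L^q` form) and
`Literature.Analysis.FunctionSpaces.tendsto_eLpNorm_fderiv_of_tendsto_eSobolevDomainNorm` (`φₖ → f` in `W^{1,p}(Ω)` forces
`Dφₖ → g` in `L^p(Ω)` for *any* weak derivative `g` of `f`, by linearity `Literature.Analysis.FunctionSpaces.HasWeakFDerivOn.sub`,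
uniqueness `Literature.Analysis.FunctionSpaces.HasWeakFDerivOn.unique_holds` and `Literature.Analysis.FunctionSpaces.HasWeakFDerivOn.of_contDiff_holds` from
`Literature.Analysis.FunctionSpaces.SobolevDomainProofs`).

## Proof

As in Evans's proof of §5.6.1 Theorem 3: given `f ∈ W₀^{1,p}(Ω)` with weak derivative `g` and
test functions `φₖ → f` in `W^{1,p}(Ω)`, the whole-space `C¹_c` inequality gives
`‖φₖ‖_{L^{p*}(Ω)} ≤ C ‖Dφₖ‖_{L^p(Ω)}` (norms over `Ω` and over `E'` agree for functions supported
in `Ω`); `Dφₖ → g` in `L^p(Ω)` because the derivative part of `‖f - φₖ‖_{W^{1,p}}` is an infimum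
over weak derivatives of `f - φₖ`, all a.e. equal to `g - Dφₖ` (`unique_holds`,
`of_contDiff_holds`), and the operator norm is bounded by the values on the basis; `φₖ → f` in
`L^p(Ω)`, so a subsequence converges a.e. (`TendstoInMeasure.exists_seq_tendsto_ae`) and Fatou's
lemma (`lintegral_liminf_le'`) yields `∫_Ω ‖f‖^{p*} ≤ liminf ∫_Ω ‖φₖ‖^{p*} ≤ (C ‖g‖_{L^p(Ω)})^{p*}`.
The constant is Mathlib's `MeasureTheory.eLpNormLESNormFDerivOfEqInnerConst μ p` (depends on
`E'`, `μ`, `p` only, as in the source, where `C = C(p, n)`).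

## References

* L. C. Evans, *Partial Differential Equations*, 2nd ed., Graduate Studies in Mathematics 19,
  AMS (2010), §5.2.3 (Theorem 1), §5.6.1 (Theorem 1 and the proof of Theorem 3).
* H. Brezis, *Functional Analysis, Sobolev Spaces and Partial Differential Equations* (2011),
  Theorem 9.9.
* R. A. Adams, *Sobolev Spaces* (1975), 5.11, inequality (21).
-/

noncomputable section

open MeasureTheory TopologicalSpace Filter
open scoped NNReal ENNReal Topology

namespace Literature.Analysis.FunctionSpaces

variable {E' : Type*} [NormedAddCommGroup E'] [NormedSpace ℝ E'] [MeasurableSpace E']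
variable {F : Type*} [NormedAddCommGroup F] [NormedSpace ℝ F]

section GNS

omit [MeasurableSpace E'] in
/-- On a finite-dimensional space the operator norm is controlled by the values on a basis:
`‖L‖ ≤ C Σᵢ ‖L bᵢ‖` with `C` depending only on the basis. [folklore] -/
theorem exists_opNorm_le_mul_sum_basis [FiniteDimensional ℝ E'] {ι : Type*} [Fintype ι]
    (b : Module.Basis ι ℝ E') :
    ∃ C : ℝ≥0, C ≠ 0 ∧ ∀ L : E' →L[ℝ] F, ‖L‖ ≤ C * ∑ i, ‖L (b i)‖ := by
  let c : ι → E' →L[ℝ] ℝ := fun i => LinearMap.toContinuousLinearMap (b.coord i)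
  refine ⟨1 + ∑ i, ‖c i‖₊, by positivity, fun L => ?_⟩
  refine ContinuousLinearMap.opNorm_le_bound _ (by positivity) fun x => ?_
  have hci : ∀ i, ‖c i‖ ≤ (1 + ∑ j, ‖c j‖₊ : ℝ≥0) := fun i => by
    push_cast
    have : ‖c i‖ ≤ ∑ j, ‖c j‖ :=
      Finset.single_le_sum (fun j _ => norm_nonneg (c j)) (Finset.mem_univ i)
    linarith [norm_nonneg (c i)]
  have hcx : ∀ i, b.repr x i = c i x := fun i => rfl
  calc ‖L x‖ = ‖∑ i, (b.repr x i) • L (b i)‖ := by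
        conv_lhs => rw [← b.sum_repr x]
        simp only [_root_.map_sum, map_smul]
    _ ≤ ∑ i, ‖(b.repr x i) • L (b i)‖ := norm_sum_le _ _
    _ = ∑ i, ‖c i x‖ * ‖L (b i)‖ := by simp only [hcx, norm_smul]
    _ ≤ ∑ i, ((1 + ∑ j, ‖c j‖₊ : ℝ≥0) * ‖x‖) * ‖L (b i)‖ := by
        gcongr with i
        exact ((c i).le_opNorm x).trans (by gcongr; exact hci i)
    _ = ((1 + ∑ j, ‖c j‖₊ : ℝ≥0) * ∑ i, ‖L (b i)‖) * ‖x‖ := by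
        rw [Finset.mul_sum, Finset.sum_mul]
        exact Finset.sum_congr rfl fun i _ => by ring

/-- `L^q` version of `exists_opNorm_le_mul_sum_basis`: the `L^q` norm of an operator-valued map is
controlled by the `L^q` norms of its values on a basis (`1 ≤ q`). [folklore] -/
theorem eLpNorm_le_mul_sum_eLpNorm_apply_basis {ι : Type*} [Fintype ι] (b : Module.Basis ι ℝ E')
    {C : ℝ≥0} (hC : ∀ L : E' →L[ℝ] F, ‖L‖ ≤ C * ∑ i, ‖L (b i)‖) {ν : Measure E'}
    {g : E' → E' →L[ℝ] F} (hg : AEStronglyMeasurable g ν) {q : ℝ≥0∞} (hq : 1 ≤ q) :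
    eLpNorm g q ν ≤ C * ∑ i, eLpNorm (fun x => g x (b i)) q ν := by
  have h1 : eLpNorm g q ν ≤ C • eLpNorm (fun x => ∑ i, ‖g x (b i)‖) q ν := by
    refine eLpNorm_le_nnreal_smul_eLpNorm_of_ae_le_mul (Filter.Eventually.of_forall fun x => ?_) q
    have h := hC (g x)
    have h0 : 0 ≤ ∑ i, ‖g x (b i)‖ := Finset.sum_nonneg fun i _ => norm_nonneg _
    rw [← NNReal.coe_le_coe]
    push_cast
    rwa [Real.norm_of_nonneg h0]
  have hmeas : ∀ i, AEStronglyMeasurable (fun x => ‖g x (b i)‖) ν := fun i =>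
    ((ContinuousLinearMap.apply ℝ F (b i)).continuous.comp_aestronglyMeasurable hg).norm
  have h2 : eLpNorm (fun x => ∑ i, ‖g x (b i)‖) q ν ≤ ∑ i, eLpNorm (fun x => g x (b i)) q ν := by
    have := eLpNorm_sum_le (μ := ν) (s := Finset.univ) (f := fun i x => ‖g x (b i)‖)
      (fun i _ => hmeas i) hq
    simp only [eLpNorm_norm] at this
    convert this using 2
    ext x
    simp
  calc eLpNorm g q ν ≤ C • eLpNorm (fun x => ∑ i, ‖g x (b i)‖) q ν := h1
    _ = C * eLpNorm (fun x => ∑ i, ‖g x (b i)‖) q ν := rfl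
    _ ≤ C * ∑ i, eLpNorm (fun x => g x (b i)) q ν := by gcongr

variable [FiniteDimensional ℝ E']

/-- Unfolding the `W^{1,p}` norm: `‖h‖_{W^{1,p}} = ‖h‖_{L^p} + inf_{g'} Σᵢ ‖g' bᵢ‖_{L^p}`. [folklore] -/
private theorem eSobolevDomainNorm_one {p : ℝ≥0∞} {Ω : Opens E'} {μ : Measure E'} {h : E' → F} :
    eSobolevDomainNorm 1 p Ω μ h = eLpNorm h p (μ.restrict Ω) +
      ⨅ (g' : E' → E' →L[ℝ] F) (_ : HasWeakFDerivOn Ω μ h g'),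
        ∑ i, eLpNorm (fun x => g' x (Module.finBasis ℝ E' i)) p (μ.restrict Ω) := by
  simp [eSobolevDomainNorm]

/-- Convergence in `W^{1,p}(Ω)` gives convergence in `L^p(Ω)`. [folklore] -/
private theorem tendsto_eLpNorm_of_tendsto_eSobolevDomainNorm {p : ℝ≥0∞} {Ω : Opens E'} {μ : Measure E'}
    {f : E' → F} {φ : ℕ → E' → F}
    (hlim : Tendsto (fun k => eSobolevDomainNorm 1 p Ω μ (f - φ k)) atTop (𝓝 0)) :
    Tendsto (fun k => eLpNorm (f - φ k) p (μ.restrict Ω)) atTop (𝓝 0) :=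
  tendsto_of_tendsto_of_tendsto_of_le_of_le tendsto_const_nhds hlim (fun _ => zero_le)
    fun _ => eLpNorm_le_eSobolevDomainNorm

/-- Convergence `φₖ → f` in `W^{1,p}(Ω)` of test functions forces `Dφₖ → g` in `L^p(Ω)` (operator
norm) for *any* weak derivative `g` of `f` on `Ω`: the infimum in the `W^{1,p}` norm is over weak
derivatives of `f - φₖ`, which are a.e. equal to `g - Dφₖ` (`HasWeakFDerivOn.unique_holds`,
`HasWeakFDerivOn.of_contDiff_holds`), and the operator norm is controlled by the values on the
basis (`eLpNorm_le_mul_sum_eLpNorm_apply_basis`). (Evans, *PDE*, §5.6.1, proof of Theorem 3: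
"`u_m ∈ C_c^∞(U)` converging to `u` in `W^{1,p}(U)`".) [cite: Evans2010, §5.6.1 Theorem 3 (proof)] -/
theorem tendsto_eLpNorm_fderiv_of_tendsto_eSobolevDomainNorm [BorelSpace E'] [CompleteSpace F]
    {p : ℝ≥0∞} (hp : 1 ≤ p)
    {Ω : Opens E'} {μ : Measure E'} [μ.IsAddHaarMeasure] {f : E' → F} {g : E' → E' →L[ℝ] F}
    (hfg : HasWeakFDerivOn Ω μ f g) {φ : ℕ → E' → F} (hφ : ∀ k, IsTestFunctionOn Ω (φ k))
    (hlim : Tendsto (fun k => eSobolevDomainNorm 1 p Ω μ (f - φ k)) atTop (𝓝 0)) :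
    Tendsto (fun k => eLpNorm (fun x => g x - fderiv ℝ (φ k) x) p (μ.restrict Ω)) atTop (𝓝 0) := by
  set b := Module.finBasis ℝ E'
  obtain ⟨Cb, hCb0, hCb⟩ := exists_opNorm_le_mul_sum_basis (F := F) b
  -- the derivative part of the Sobolev norm tends to zero
  set I : ℕ → ℝ≥0∞ := fun k => ⨅ (g' : E' → E' →L[ℝ] F) (_ : HasWeakFDerivOn Ω μ (f - φ k) g'),
    ∑ i, eLpNorm (fun x => g' x (b i)) p (μ.restrict Ω) with hI_def
  have hI : Tendsto I atTop (𝓝 0) := by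
    refine tendsto_of_tendsto_of_tendsto_of_le_of_le tendsto_const_nhds hlim (fun _ => zero_le)
      fun k => ?_
    rw [eSobolevDomainNorm_one]
    exact le_add_self
  -- each admissible `g'` is a.e. `g - Dφₖ`
  have hkey : ∀ k, eLpNorm (fun x => g x - fderiv ℝ (φ k) x) p (μ.restrict Ω) ≤ Cb * I k := by
    intro k
    have hφk : HasWeakFDerivOn Ω μ (φ k) (fderiv ℝ (φ k)) :=
      HasWeakFDerivOn.of_contDiff_holds Ω μ ((hφ k).contDiff.of_le (by simp))
    have hd : HasWeakFDerivOn Ω μ (f - φ k) (g - fderiv ℝ (φ k)) := hfg.sub hφk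
    have h1 : ∀ g', HasWeakFDerivOn Ω μ (f - φ k) g' →
        eLpNorm (fun x => g x - fderiv ℝ (φ k) x) p (μ.restrict Ω) ≤
          Cb * ∑ i, eLpNorm (fun x => g' x (b i)) p (μ.restrict Ω) := by
      intro g' hg'
      have hae : g' =ᵐ[μ.restrict Ω] (g - fderiv ℝ (φ k)) := HasWeakFDerivOn.unique_holds hg' hd
      calc eLpNorm (fun x => g x - fderiv ℝ (φ k) x) p (μ.restrict Ω)
          = eLpNorm g' p (μ.restrict Ω) := (eLpNorm_congr_ae hae).symm
        _ ≤ Cb * ∑ i, eLpNorm (fun x => g' x (b i)) p (μ.restrict Ω) :=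
          eLpNorm_le_mul_sum_eLpNorm_apply_basis b hCb
            hg'.locallyIntegrableOn_deriv.aestronglyMeasurable hp
    calc eLpNorm (fun x => g x - fderiv ℝ (φ k) x) p (μ.restrict Ω)
        ≤ ⨅ (g' : E' → E' →L[ℝ] F) (_ : HasWeakFDerivOn Ω μ (f - φ k) g'),
            Cb * ∑ i, eLpNorm (fun x => g' x (b i)) p (μ.restrict Ω) := le_iInf₂ h1
      _ = Cb * I k := by
        simp only [hI_def]
        rw [ENNReal.mul_iInf_of_ne (by exact_mod_cast hCb0) ENNReal.coe_ne_top]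
        refine iInf_congr fun g' => ?_
        rw [ENNReal.mul_iInf_of_ne (by exact_mod_cast hCb0) ENNReal.coe_ne_top]
  have hCI : Tendsto (fun k => (Cb : ℝ≥0∞) * I k) atTop (𝓝 0) := by
    simpa using ENNReal.Tendsto.const_mul hI (Or.inr ENNReal.coe_ne_top)
  exact tendsto_of_tendsto_of_tendsto_of_le_of_le tendsto_const_nhds hCI (fun _ => zero_le) hkey

/-- **Discharge of `gagliardo_nirenberg_sobolev`.** The Gagliardo–Nirenberg–Sobolev inequality
on `W₀^{1,p}(Ω)`, `‖f‖_{L^{p*}(Ω)} ≤ C ‖Df‖_{L^p(Ω)}` for `1 ≤ p < n`, `1/p* = 1/p - 1/n`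
(Evans, *PDE*, §5.6.1, Theorem 1 for `C¹_c` and the proof of Theorem 3 for `W₀^{1,p}`; Brezis,
Thm. 9.9). Proof as in Evans: for test functions this is the `C¹_c` inequality on the whole space
(`Literature.Analysis.FunctionSpaces.eLpNorm_le_mul_eLpNorm_fderiv_of_eq`, Mathlib's argument extended to an arbitrary complete —
indeed arbitrary — normed codomain by norming functionals), the norms over `Ω` and over `E'`
agreeing for functions supported in `Ω`; for `f ∈ W₀^{1,p}(Ω)` take test functions `φₖ → f` in
`W^{1,p}(Ω)`: then `φₖ → f` in `L^p(Ω)`, `Dφₖ → g` in `L^p(Ω)`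
(`tendsto_eLpNorm_fderiv_of_tendsto_eSobolevDomainNorm`), a subsequence converges a.e., and
Fatou's lemma gives `∫_Ω ‖f‖^{p*} ≤ liminf ∫_Ω ‖φₖ‖^{p*} ≤ (C ‖g‖_{L^p(Ω)})^{p*}`. The constant is
Mathlib's `MeasureTheory.eLpNormLESNormFDerivOfEqInnerConst μ p` (depends on `E'`, `μ`, `p`
only). [cite: Evans2010, §5.6.1 Theorem 1] [cite: Brezis2011, Thm. 9.9] -/
theorem gagliardo_nirenberg_sobolev_holds :
    gagliardo_nirenberg_sobolev (E' := E') (F := F) := by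
  intro _ _ Ω p p' hp hpn hp' μ _
  have hp1 : (1 : ℝ≥0∞) ≤ p := by exact_mod_cast hp
  have hp0 : (p : ℝ≥0∞) ≠ 0 := (zero_lt_one.trans_le hp1).ne'
  have hn : 0 < Module.finrank ℝ E' := by
    have h : (0 : ℝ) < Module.finrank ℝ E' :=
      (zero_lt_one.trans_le (show (1 : ℝ) ≤ p by exact_mod_cast hp)).trans hpn
    exact_mod_cast h
  have hp'0 : p' ≠ 0 := by
    rintro rfl
    have h : (p : ℝ)⁻¹ = (Module.finrank ℝ E' : ℝ)⁻¹ := by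
      rw [NNReal.coe_zero, inv_zero] at hp'
      linarith
    exact hpn.ne (inv_inj.1 h)
  have hp'pos : 0 < (p' : ℝ) := by positivity
  set C₁ : ℝ≥0 := eLpNormLESNormFDerivOfEqInnerConst μ p with hC₁
  refine ⟨C₁, fun f g hf hg => ?_⟩
  set μΩ := μ.restrict (Ω : Set E') with hμΩ
  obtain ⟨φ, hφ, hlim⟩ := hf.2
  have hDlim := tendsto_eLpNorm_fderiv_of_tendsto_eSobolevDomainNorm hp1 hg hφ hlim
  have hLp := tendsto_eLpNorm_of_tendsto_eSobolevDomainNorm hlim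
  -- measurability
  have hfm : AEStronglyMeasurable f μΩ := hf.1.memLp.aestronglyMeasurable
  have hφm : ∀ k, AEStronglyMeasurable (φ k) μΩ := fun k =>
    (hφ k).contDiff.continuous.aestronglyMeasurable
  have hgm : AEStronglyMeasurable g μΩ := hg.locallyIntegrableOn_deriv.aestronglyMeasurable
  have hDφm : ∀ k, AEStronglyMeasurable (fderiv ℝ (φ k)) μΩ := fun k =>
    ((hφ k).contDiff.continuous_fderiv (by simp)).aestronglyMeasurable
  -- a subsequence converging a.e. on `Ω`
  have hmeas : TendstoInMeasure μΩ φ atTop f := by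
    refine tendstoInMeasure_of_tendsto_eLpNorm hp0 hφm hfm ?_
    simpa only [eLpNorm_sub_comm] using hLp
  obtain ⟨ns, hns, hae⟩ := hmeas.exists_seq_tendsto_ae
  -- GNS for the test functions, on `Ω`
  have hGNS : ∀ k, eLpNorm (φ k) p' μΩ ≤ C₁ * eLpNorm (fderiv ℝ (φ k)) p μΩ := by
    intro k
    have h1 := eLpNorm_le_mul_eLpNorm_fderiv_of_eq μ ((hφ k).contDiff.of_le (by simp))
      (hφ k).hasCompactSupport hp hn hp'
    have hs : Function.support (φ k) ⊆ (Ω : Set E') :=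
      (subset_tsupport _).trans (hφ k).tsupport_subset
    have e1 : eLpNorm (φ k) p' μΩ = eLpNorm (φ k) p' μ :=
      eLpNorm_restrict_eq_of_support_subset hs
    -- for the operator-valued derivative go through the scalar function `‖Dφₖ‖`
    have e2 : eLpNorm (fderiv ℝ (φ k)) p μΩ = eLpNorm (fderiv ℝ (φ k)) p μ := by
      rw [← eLpNorm_norm (fderiv ℝ (φ k)), ← eLpNorm_norm (fderiv ℝ (φ k))]
      refine eLpNorm_restrict_eq_of_support_subset fun x hx => ?_
      contrapose! hx
      simp [fderiv_of_notMem_tsupport ℝ fun h => hx ((hφ k).tsupport_subset h)]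
    rw [e1, e2]
    exact h1
  -- triangle inequality for the derivatives
  set e : ℕ → ℝ≥0∞ := fun k => eLpNorm (fun x => g x - fderiv ℝ (φ k) x) p μΩ with he_def
  have htri : ∀ k, eLpNorm (fderiv ℝ (φ k)) p μΩ ≤ eLpNorm g p μΩ + e k := by
    intro k
    calc eLpNorm (fderiv ℝ (φ k)) p μΩ
        = eLpNorm (g - fun x => g x - fderiv ℝ (φ k) x) p μΩ := by
          congr 1; funext x; simp
      _ ≤ eLpNorm g p μΩ + e k := eLpNorm_sub_le hgm (hgm.sub (hDφm k)) hp1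
  -- the bound along the subsequence, raised to the power `p'`
  have hbound : ∀ k, ∫⁻ x, ‖φ (ns k) x‖ₑ ^ (p' : ℝ) ∂μΩ ≤
      ((C₁ : ℝ≥0∞) * (eLpNorm g p μΩ + e (ns k))) ^ (p' : ℝ) := by
    intro k
    rw [← eLpNorm_nnreal_pow_eq_lintegral hp'0]
    gcongr
    exact (hGNS _).trans (by gcongr; exact htri _)
  have hlimit : Tendsto (fun k => ((C₁ : ℝ≥0∞) * (eLpNorm g p μΩ + e (ns k))) ^ (p' : ℝ)) atTop
      (𝓝 (((C₁ : ℝ≥0∞) * eLpNorm g p μΩ) ^ (p' : ℝ))) := by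
    have he : Tendsto (fun k => e (ns k)) atTop (𝓝 0) := hDlim.comp hns.tendsto_atTop
    have h2 : Tendsto (fun k => (C₁ : ℝ≥0∞) * (eLpNorm g p μΩ + e (ns k))) atTop
        (𝓝 ((C₁ : ℝ≥0∞) * eLpNorm g p μΩ)) := by
      have h3 : Tendsto (fun k => eLpNorm g p μΩ + e (ns k)) atTop (𝓝 (eLpNorm g p μΩ + 0)) :=
        tendsto_const_nhds.add he
      rw [add_zero] at h3
      exact ENNReal.Tendsto.const_mul h3 (Or.inr ENNReal.coe_ne_top)
    exact (ENNReal.continuous_rpow_const.tendsto _).comp h2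
  -- Fatou
  have hFatou : ∫⁻ x, ‖f x‖ₑ ^ (p' : ℝ) ∂μΩ ≤ ((C₁ : ℝ≥0∞) * eLpNorm g p μΩ) ^ (p' : ℝ) := by
    have h1 : ∀ᵐ x ∂μΩ, ‖f x‖ₑ ^ (p' : ℝ) =
        liminf (fun k => ‖φ (ns k) x‖ₑ ^ (p' : ℝ)) atTop := by
      filter_upwards [hae] with x hx
      exact (((ENNReal.continuous_rpow_const.tendsto _).comp
        ((continuous_enorm.tendsto _).comp hx)).liminf_eq).symm
    have h2 : ∀ k, AEMeasurable (fun x => ‖φ (ns k) x‖ₑ ^ (p' : ℝ)) μΩ := fun k =>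
      ((hφ (ns k)).contDiff.continuous.enorm.measurable.pow_const _).aemeasurable
    calc ∫⁻ x, ‖f x‖ₑ ^ (p' : ℝ) ∂μΩ
        = ∫⁻ x, liminf (fun k => ‖φ (ns k) x‖ₑ ^ (p' : ℝ)) atTop ∂μΩ := lintegral_congr_ae h1
      _ ≤ liminf (fun k => ∫⁻ x, ‖φ (ns k) x‖ₑ ^ (p' : ℝ) ∂μΩ) atTop := lintegral_liminf_le' h2
      _ ≤ liminf (fun k => ((C₁ : ℝ≥0∞) * (eLpNorm g p μΩ + e (ns k))) ^ (p' : ℝ)) atTop :=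
          liminf_le_liminf (Filter.Eventually.of_forall hbound)
      _ = ((C₁ : ℝ≥0∞) * eLpNorm g p μΩ) ^ (p' : ℝ) := hlimit.liminf_eq
  calc eLpNorm f p' μΩ = (∫⁻ x, ‖f x‖ₑ ^ (p' : ℝ) ∂μΩ) ^ (1 / (p' : ℝ)) :=
        eLpNorm_nnreal_eq_lintegral hp'0
    _ ≤ (((C₁ : ℝ≥0∞) * eLpNorm g p μΩ) ^ (p' : ℝ)) ^ (1 / (p' : ℝ)) := by gcongr
    _ = C₁ * eLpNorm g p μΩ := by rw [one_div, ENNReal.rpow_rpow_inv hp'pos.ne']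

end GNS

end Literature.Analysis.FunctionSpaces
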